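import Mathlib
import HarnessLib
import Summits.PneNP.PneNP.Theses.CnfIdealGenLength
import Summits.PneNP.PneNP.Theorems.CnfIdealGenLengthRankCount
import Summits.PneNP.PneNP.Theorems.CnfIdealGenLengthRankStability

/-!
# Sketch — crux-ideate round 1 for `CnfIdealGenLength.RankDefectRepresentations` (stmt-PneNP-18923)

First lemmas of the three idea cards (`rank-dehn-ladder`, `phantom-kernel`, `splitting-holonomy`).
Stubs are `sorry`; only elaboration is claimed.
-/

namespace Summit.PneNP.PneNP.Cruxes.RankDefectRepresentations

open Filter
open Literature.Computability.Complexity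
open Literature.Computability.MetaComplexity
open Literature.Computability.MetaComplexity.NCIPS
open Summit.PneNP.PneNP.Theses.CnfIdealGenLength

/-- Evaluation of a non-commutative polynomial at a matrix tuple `M` (the map used in the crux). -/
noncomputable abbrev ev {K : Type} [Field K] {n d : ℕ} (M : Fin n → Matrix (Fin d) (Fin d) K)
    (g : MonoidAlgebra K (FreeMonoid (Fin n))) : Matrix (Fin d) (Fin d) K :=
  MonoidAlgebra.lift K (Matrix (Fin d) (Fin d) K) (FreeMonoid (Fin n)) (FreeMonoid.lift M) g

/-- `M` is an almost-representation of the Boolean cube with axiom defects of rank `≤ t`. -/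
def AlmostRep {K : Type} [Field K] {n d : ℕ} (M : Fin n → Matrix (Fin d) (Fin d) K) (t : ℕ) : Prop :=
  ∀ g : MonoidAlgebra K (FreeMonoid (Fin n)), IsAxiom g → (ev M g).rank ≤ t

/-- `M'` is a genuine representation: a commuting tuple of idempotents. -/
def Genuine {K : Type} [Field K] {n d : ℕ} (M' : Fin n → Matrix (Fin d) (Fin d) K) : Prop :=
  (∀ i, M' i * M' i = M' i) ∧ ∀ i j, M' i * M' j = M' j * M' i

/-- `M` is at coordinatewise rank distance `> D` from every genuine tuple of the same size. -/
def FarFromGenuine {K : Type} [Field K] {n d : ℕ} (M : Fin n → Matrix (Fin d) (Fin d) K) (D : ℕ) :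
    Prop :=
  ∀ M' : Fin n → Matrix (Fin d) (Fin d) K, Genuine M' → ∃ i, D < (M i - M' i).rank

/-! ## Card `rank-dehn-ladder`: the CNF-free instability rung T1, the detection rung T2, and the
invariant-submodule bound. -/

/-- T1 — superpolynomial rank-instability of the cube presentation (CNF-free, order-free). -/
def SuperpolyInstability : Prop :=
  ∀ c : ℕ, ∀ᶠ n : ℕ in atTop, ∃ (K : Type) (_ : Field K) (_ : CharZero K) (d t : ℕ)
    (M : Fin n → Matrix (Fin d) (Fin d) K), AlmostRep M t ∧ FarFromGenuine M (n ^ c * t)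

/-- T2 — polynomial CNF detection: every almost-representation far from genuine is caught, up to a
polynomial loss, by the clause product of SOME polynomial-size unsatisfiable CNF. -/
def CnfDetection : Prop :=
  ∃ p q : Polynomial ℕ, ∀ n : ℕ, ∀ (K : Type) [Field K] [CharZero K] (d t D : ℕ)
    (M : Fin n → Matrix (Fin d) (Fin d) K), AlmostRep M t → FarFromGenuine M D →
    ∃ φ : CNF (Fin n), ¬ φ.Satisfiable ∧ CNF.numClauses φ ≤ p.eval n ∧ CNF.size φ ≤ p.eval n ∧
      D ≤ q.eval n * (ev M (clauseProduct K φ)).rank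

/-- Crude polynomial growth bound over `ℕ`: `p(n) ≤ p(1)·n^{deg p}` for `n ≥ 1`. -/
theorem eval_le_eval_one_mul_pow (p : Polynomial ℕ) {n : ℕ} (hn : 1 ≤ n) :
    p.eval n ≤ p.eval 1 * n ^ p.natDegree := by
  rw [Polynomial.eval_eq_sum_range, Polynomial.eval_eq_sum_range, Finset.sum_mul]
  apply Finset.sum_le_sum
  intro i hi
  rw [one_pow, mul_one]
  exact Nat.mul_le_mul_left _ (Nat.pow_le_pow_right hn (Nat.lt_succ_iff.mp (Finset.mem_range.mp hi)))

/-- RDR forces T1 (contrapositive companion of `not_rankDefectRepresentations_of_polyStable`,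
via `rank_eval_clauseProduct_le_size_mul`). PROVED (sorry-free). -/
theorem superpolyInstability_of_rdr : RankDefectRepresentations → SuperpolyInstability := by
  rintro ⟨p, φ, hφ, h⟩ c
  filter_upwards [h (p.natDegree + c + 1), Filter.eventually_ge_atTop (p.eval 1 + 1)] with n hn hn1
  obtain ⟨K, _, _, d, t, M, hM, hlt⟩ := hn
  refine ⟨K, inferInstance, inferInstance, d, t, M, hM, ?_⟩
  intro M' hM'
  by_contra hcon
  push_neg at hcon
  have hle := Summit.PneNP.PneNP.Theorems.CnfIdealGenLength.rank_eval_clauseProduct_le_size_mul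
    M M' hM'.1 hM'.2 (hφ n).1 hcon
  have hsize : (φ n).size ≤ p.eval n := (hφ n).2.2
  have hp : p.eval n ≤ p.eval 1 * n ^ p.natDegree := eval_le_eval_one_mul_pow p (by omega)
  have key : n ^ (p.natDegree + c + 1) * t ≤ (φ n).size * (n ^ c * t) := (le_of_lt hlt).trans hle
  have h2 : (φ n).size * (n ^ c * t) ≤ p.eval 1 * n ^ p.natDegree * (n ^ c * t) :=
    Nat.mul_le_mul_right _ (hsize.trans hp)
  have h3 : p.eval 1 * n ^ p.natDegree * (n ^ c * t) ≤ n * n ^ p.natDegree * (n ^ c * t) :=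
    Nat.mul_le_mul_right _ (Nat.mul_le_mul_right _ (by omega))
  have h4 : n * n ^ p.natDegree * (n ^ c * t) = n ^ (p.natDegree + c + 1) * t := by ring
  have h5 : n ^ (p.natDegree + c + 1) * t < n ^ (p.natDegree + c + 1) * t :=
    lt_of_lt_of_le hlt (hle.trans (h2.trans (h3.trans h4.le)))
  exact lt_irrefl _ h5

/-- T1 ∧ T2 ⇒ RDR (diagonal choice of `φ n`). -/
theorem stub_rdr_of_instability_of_detection :
    SuperpolyInstability → CnfDetection → RankDefectRepresentations := by
  sorry

/-- Invariant-submodule bound: a subspace `W` invariant under every `M i` on which all axioms vanish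
yields a genuine tuple (`M` on `W`, `0` on a complement) within coordinatewise rank `codim W`. -/
theorem stub_near_genuine_of_invariant {K : Type} [Field K] {n d : ℕ}
    (M : Fin n → Matrix (Fin d) (Fin d) K) (W : Submodule K (Fin d → K))
    (hinv : ∀ i, ∀ v ∈ W, (M i).mulVec v ∈ W)
    (hrel : ∀ g : MonoidAlgebra K (FreeMonoid (Fin n)), IsAxiom g → ∀ v ∈ W, (ev M g).mulVec v = 0) :
    ∃ M' : Fin n → Matrix (Fin d) (Fin d) K, Genuine M' ∧
      ∀ i, (M i - M' i).rank ≤ d - Module.finrank K W := by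
  sorry

/-- The sorted word `x_{i₁} ⋯ x_{i_k}` (`i₁ < ⋯ < i_k`) of a set of variables. -/
def sortedWord {n : ℕ} (S : Finset (Fin n)) : FreeMonoid (Fin n) :=
  FreeMonoid.ofList (S.sort (· ≤ ·))

/-- Sorting (uniform-model) lemma: the sorted products form a uniform almost-representation of the
free semilattice `2^[n]` with defect `≤ (|S|·|T| + |S ∩ T|)·t` (area of the cube presentation). -/
theorem stub_uniform_defect {K : Type} [Field K] {n d t : ℕ} (M : Fin n → Matrix (Fin d) (Fin d) K)
    (hM : AlmostRep M t) (S T : Finset (Fin n)) :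
    (ev M (MonoidAlgebra.of K _ (sortedWord S)) * ev M (MonoidAlgebra.of K _ (sortedWord T)) -
        ev M (MonoidAlgebra.of K _ (sortedWord (S ∪ T)))).rank ≤ (S.card * T.card + (S ∩ T).card) * t := by
  sorry

/-! ## Card `phantom-kernel`: partial non-commutative models. -/

/-- The phantom kernel: the common kernel of all clause words `Q_κ(M)`, `κ ∈ φ`. -/
noncomputable def phantomKernel {K : Type} [Field K] {n d : ℕ} (M : Fin n → Matrix (Fin d) (Fin d) K)
    (φ : CNF (Fin n)) : Submodule K (Fin d → K) :=
  ⨅ κ ∈ φ, LinearMap.ker (Matrix.toLin' (ev M (clauseWord K κ)))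

/-- PNC — phantom null-space representations: as RDR, with `rank P_φ(M)` replaced by the dimension of
the common kernel of the clause words (clause-order-free). -/
def PhantomKernelRepresentations : Prop :=
  ∃ p : Polynomial ℕ, ∃ φ : (n : ℕ) → CNF (Fin n),
    (∀ n, ¬ (φ n).Satisfiable ∧ CNF.numClauses (φ n) ≤ p.eval n ∧ CNF.size (φ n) ≤ p.eval n) ∧
    ∀ c : ℕ, ∀ᶠ n : ℕ in atTop, ∃ (K : Type) (_ : Field K) (_ : CharZero K) (d t : ℕ)
      (M : Fin n → Matrix (Fin d) (Fin d) K),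
      AlmostRep M t ∧ n ^ c * t < Module.finrank K (phantomKernel M (φ n))

/-- Membership in the phantom kernel, unfolded. -/
theorem mem_phantomKernel_iff {K : Type} [Field K] {n d : ℕ} (M : Fin n → Matrix (Fin d) (Fin d) K)
    (φ : CNF (Fin n)) (u : Fin d → K) :
    u ∈ phantomKernel M φ ↔ ∀ κ ∈ φ, (ev M (clauseWord K κ)).mulVec u = 0 := by
  simp [phantomKernel, Submodule.mem_iInf, LinearMap.mem_ker, Matrix.toLin'_apply]

/-- Peeling: if every clause word kills `u`, then `P_φ(M) u = u` (factors `1 - Q_κ` right to left;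
no commutation and no clause order used). PROVED. -/
theorem clauseProduct_mulVec_of_forall {K : Type} [Field K] {n d : ℕ}
    (M : Fin n → Matrix (Fin d) (Fin d) K) (φ : CNF (Fin n)) (u : Fin d → K)
    (hu : ∀ κ ∈ φ, (ev M (clauseWord K κ)).mulVec u = 0) :
    (ev M (clauseProduct K φ)).mulVec u = u := by
  induction φ with
  | nil => simp [clauseProduct_nil]
  | cons κ φ ih =>
    have hκ : (ev M (clauseWord K κ)).mulVec u = 0 := hu κ (by simp)
    have ih' := ih (fun κ' hκ' => hu κ' (by simp [hκ']))
    simp only [ev] at ih' hκ ⊢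
    rw [clauseProduct_cons, map_mul, ← Matrix.mulVec_mulVec, ih', map_sub, map_one,
      Matrix.sub_mulVec, Matrix.one_mulVec, hκ, sub_zero]

/-- `P_φ(M)` is the identity on the phantom kernel. PROVED. -/
theorem clauseProduct_mulVec_of_mem_phantomKernel {K : Type} [Field K] {n d : ℕ}
    (M : Fin n → Matrix (Fin d) (Fin d) K) (φ : CNF (Fin n)) (u : Fin d → K)
    (hu : u ∈ phantomKernel M φ) : (ev M (clauseProduct K φ)).mulVec u = u :=
  clauseProduct_mulVec_of_forall M φ u ((mem_phantomKernel_iff M φ u).1 hu)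

/-- Hence `dim (phantom kernel) ≤ rank P_φ(M)` for EVERY tuple `M`. PROVED. -/
theorem finrank_phantomKernel_le_rank {K : Type} [Field K] {n d : ℕ}
    (M : Fin n → Matrix (Fin d) (Fin d) K) (φ : CNF (Fin n)) :
    Module.finrank K (phantomKernel M φ) ≤ (ev M (clauseProduct K φ)).rank := by
  unfold Matrix.rank
  apply Submodule.finrank_mono
  intro u hu
  refine ⟨u, ?_⟩
  rw [Matrix.mulVecLin_apply]
  exact clauseProduct_mulVec_of_mem_phantomKernel M φ u hu

/-- PNC ⇒ RDR. PROVED (sorry-free). -/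
theorem rdr_of_phantomKernelRepresentations :
    PhantomKernelRepresentations → RankDefectRepresentations := by
  rintro ⟨p, φ, hφ, h⟩
  refine ⟨p, φ, hφ, fun c => ?_⟩
  filter_upwards [h c] with n hn
  obtain ⟨K, _, _, d, t, M, hM, hlt⟩ := hn
  exact ⟨K, inferInstance, inferInstance, d, t, M, hM,
    lt_of_lt_of_le hlt (finrank_phantomKernel_le_rank M (φ n))⟩

/-! ## Card `splitting-holonomy`: exact idempotents WLOG; pairwise compatibility of splittings as a
non-abelian cocycle modulo low rank. -/

/-- Fitting: an almost-idempotent is within rank `t` of an idempotent. -/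
theorem stub_exists_idempotent_near {K : Type} [Field K] {d t : ℕ} (A : Matrix (Fin d) (Fin d) K)
    (hA : (A * A - A).rank ≤ t) : ∃ E : Matrix (Fin d) (Fin d) K, E * E = E ∧ (A - E).rank ≤ t := by
  sorry

/-- Pairwise compatibility of two splittings modulo rank `r`: the transition matrix factors through the
two block-centralisers up to a rank-`r` correction. -/
def PairCompatible {K : Type} [Field K] {d : ℕ} (E F : Matrix (Fin d) (Fin d) K)
    (U V : Matrix (Fin d) (Fin d) K) (r : ℕ) : Prop :=
  ∃ a b L : Matrix (Fin d) (Fin d) K, a * E = E * a ∧ b * F = F * b ∧ L.rank ≤ r ∧ V = U * a * b + L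

/-- Two steps of the cocycle problem are always linear (n = 2 is stable with linear rate): if the
conjugated idempotents `U E U⁻¹`, `V F V⁻¹` (with `E`, `F` commuting idempotents) are pairwise compatible
modulo rank `r`, they are within rank `6r` of a commuting pair (`2r` when the centraliser factors
`a`, `b` are units: take `E' = UEU⁻¹`, `F' = UaFa⁻¹U⁻¹`; in general first move `a`, `b` to units inside
`C(E)`, `C(F)` at rank cost `corank a + corank b ≤ 2r`).  The n ≥ 3 analogue with a
polynomial bound is the content of T1's negation; the card proposes families where it fails. -/
theorem stub_two_splittings_linear {K : Type} [Field K] {d r : ℕ} (E F U V : Matrix (Fin d) (Fin d) K)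
    (hE : E * E = E) (hF : F * F = F) (hEF : E * F = F * E) (hU : IsUnit U) (hV : IsUnit V)
    (h : PairCompatible E F U V r) :
    ∃ E' F' : Matrix (Fin d) (Fin d) K, E' * E' = E' ∧ F' * F' = F' ∧ E' * F' = F' * E' ∧
      (U * E * U⁻¹ - E').rank ≤ 6 * r ∧ (V * F * V⁻¹ - F').rank ≤ 6 * r := by
  sorry

end Summit.PneNP.PneNP.Cruxes.RankDefectRepresentations
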